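import Summits.CriticalPhenomena.PercolationContinuityZ3.Theorems.PercNearOneGluingNoHeavyLowerTailStarSetSupplyU0Words
import Summits.CriticalPhenomena.PercolationContinuityZ3.Theorems.PercNearOneGluingNoHeavyLowerTailStarSetSupplyGlue
import Summits.CriticalPhenomena.PercolationContinuityZ3.Theorems.PercNearOneGluingNoHeavyLowerTailStarSetFibreCount
import Summits.CriticalPhenomena.PercolationContinuityZ3.Theorems.PercNearOneGluingNoHeavyLowerTailStarSetWordPorts
import HarnessLib

/-!
# `NoHeavyLowerTail` (stmt-CriticalPhenomena-4575) — U0' assembly, part 2: the pairs' second-order charges fit in the budget (MWF-CERT §5 Step 2)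

Support file (prover `prim-gen-swap` gen 9; `--supports stmt-CriticalPhenomena-4575`).  No definitions, no named facts, no sorries.
For a family `AdjSet K` of classes adjacent to (and different from) each chord `Fin.natAdd Mf K`, every chord dominated at each port by an
adjacent forest class off the chord (`hdomF`): `Σ_K Σ_{J∈AdjSet K} Σ_{i∈K} Σ_{j∈J} coef(e₀)·θ_iθ_j ≤ Σ_{|R_e|≥3} coef(e)`
(`StarSet.pairs_supply_le_budget`).  Pair geometry (shared port `q`, far end `pK`, partner port `sJ`, dominating class `N ∋ pK` with other
port `v` via `Classical.choose`), `StarSet.pair_words_supply`, the charge set as an iterated `Finset.sigma`, `StarSet.sum_le_six_mul_of_fibres`.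
-/

noncomputable section

namespace Summit.CriticalPhenomena.PercolationContinuityZ3.Theorems

open Finset
open scoped Classical BigOperators

namespace StarSet

variable {n m Mf Mc : ℕ}

/-- **The adjacent pairs' second-order charges fit in the hair budget.**  See the file header. [MWF-CERT.md §5 Step 2] -/
theorem pairs_supply_le_budget (w : Sym2 (Fin n) → unitInterval) (s p p' : Fin m → Fin n)
    (cls : Fin m → Fin (Mf + Mc)) (P P' : Fin (Mf + Mc) → Fin n) (hP : ∀ i, p i = P (cls i)) (hP' : ∀ i, p' i = P' (cls i))
    (hPP' : ∀ κ, P κ ≠ P' κ)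
    (hnopar : ∀ I K : Fin (Mf + Mc), I ≠ K → ¬ ((P K = P I ∨ P K = P' I) ∧ (P' K = P I ∨ P' K = P' I)))
    (hdomF : ∀ K : Fin Mc, ∀ d : Fin n, (d = P (Fin.natAdd Mf K) ∨ d = P' (Fin.natAdd Mf K)) →
      ∃ I : Fin Mf, (P (Fin.castAdd Mc I) = d ∨ P' (Fin.castAdd Mc I) = d) ∧
        (P (Fin.castAdd Mc I) ∉ ({P (Fin.natAdd Mf K), P' (Fin.natAdd Mf K)} : Finset (Fin n)) ∨
          P' (Fin.castAdd Mc I) ∉ ({P (Fin.natAdd Mf K), P' (Fin.natAdd Mf K)} : Finset (Fin n))) ∧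
        ∏ i ∈ Finset.univ.filter (fun i => cls i = Fin.castAdd Mc I), (1 - (w s(s i, p i) : ℝ) * w s(s i, p' i)) ≤
          ∏ i ∈ Finset.univ.filter (fun i => cls i = Fin.natAdd Mf K), (1 - (w s(s i, p i) : ℝ) * w s(s i, p' i)))
    (AdjSet : Fin Mc → Finset (Fin (Mf + Mc)))
    (hAdj : ∀ K, ∀ J ∈ AdjSet K, J ≠ Fin.natAdd Mf K ∧ (P J = P (Fin.natAdd Mf K) ∨ P J = P' (Fin.natAdd Mf K) ∨
      P' J = P (Fin.natAdd Mf K) ∨ P' J = P' (Fin.natAdd Mf K))) :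
    ∑ K : Fin Mc, ∑ J ∈ AdjSet K, ∑ i ∈ Finset.univ.filter (fun i => cls i = Fin.natAdd Mf K), ∑ j ∈ Finset.univ.filter (fun j => cls j = J),
        (∏ i, (if (w s(s i, p i) : ℝ) * w s(s i, p' i) < 1 then
          ((1 - (w s(s i, p i) : ℝ)) * (1 - w s(s i, p' i))) / (1 - (w s(s i, p i) : ℝ) * w s(s i, p' i)) else 0)) *
          (((w s(s i, p i) : ℝ) * w s(s i, p' i)) * ((w s(s j, p j) : ℝ) * w s(s j, p' j))) ≤
      ∑ e : Fin m → Fin 3, (if 3 ≤ ((Finset.univ.filter fun i => e i = 1).image p ∪ (Finset.univ.filter fun i => e i = 2).image p').card then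
        ∏ i, (if (w s(s i, p i) : ℝ) * w s(s i, p' i) < 1 then
            ((if e i = 1 then (w s(s i, p i) : ℝ) else 1 - w s(s i, p i)) *
              (if e i = 2 then (w s(s i, p' i) : ℝ) else 1 - w s(s i, p' i))) / (1 - (w s(s i, p i) : ℝ) * w s(s i, p' i))
          else if e i = 1 then 1 else 0) else 0) := by
  -- abbreviations
  set θ : Fin m → ℝ := fun i => (w s(s i, p i) : ℝ) * w s(s i, p' i) with hθ
  have hθ0 : ∀ i, 0 ≤ θ i := fun i => mul_nonneg (w _).2.1 (w _).2.1
  have hθ1 : ∀ i, θ i ≤ 1 := fun i => mul_le_one₀ (w _).2.2 (w _).2.1 (w _).2.2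
  set St : Fin (Mf + Mc) → Finset (Fin m) := fun κ => univ.filter (fun i => cls i = κ) with hSt
  set uu : Fin (Mf + Mc) → ℝ := fun κ => ∏ i ∈ univ.filter (fun i => cls i = κ), (1 - θ i) with huu
  set touch : Fin (Mf + Mc) → Fin (Mf + Mc) → Prop := fun κ' κ => P κ' = P κ ∨ P κ' = P' κ ∨ P' κ' = P κ ∨ P' κ' = P' κ with htouch
  set A : Fin m → Fin 3 → ℝ := fun x k => if θ x < 1 then
      ((if k = 1 then (w s(s x, p x) : ℝ) else 1 - w s(s x, p x)) * (if k = 2 then (w s(s x, p' x) : ℝ) else 1 - w s(s x, p' x))) / (1 - θ x)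
    else if k = 1 then 1 else 0 with hA
  have hAnn : ∀ x k, 0 ≤ A x k := fun x k => extremeCoeff_nonneg _ _ (w _).2.1 (w _).2.2 (w _).2.1 (w _).2.2 k
  have hA0 : ∀ x, (if θ x < 1 then ((1 - (w s(s x, p x) : ℝ)) * (1 - w s(s x, p' x))) / (1 - θ x) else 0) = A x 0 := by
    intro x; simp only [hA]; simp
  set coef : (Fin m → Fin 3) → ℝ := fun e => ∏ x, A x (e x) with hcoef
  have hcoefnn : ∀ e, 0 ≤ coef e := fun e => prod_nonneg fun x _ => hAnn x (e x)
  set C0 : ℝ := ∏ x, A x 0 with hC0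
  set Rw : (Fin m → Fin 3) → Finset (Fin n) := fun e =>
    (univ.filter fun i => e i = 1).image p ∪ (univ.filter fun i => e i = 2).image p' with hRw
  have hE0 : (∏ x, (if θ x < 1 then ((1 - (w s(s x, p x) : ℝ)) * (1 - w s(s x, p' x))) / (1 - θ x) else 0)) = C0 :=
    prod_congr rfl fun x _ => hA0 x
  change ∑ K, ∑ J ∈ AdjSet K, ∑ i ∈ St (Fin.natAdd Mf K), ∑ j ∈ St J,
      (∏ x, (if θ x < 1 then ((1 - (w s(s x, p x) : ℝ)) * (1 - w s(s x, p' x))) / (1 - θ x) else 0)) * (θ i * θ j) ≤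
    ∑ e, (if 3 ≤ (Rw e).card then coef e else 0)
  rw [hE0]
  -- (5) geometry of a pair: shared port `q`, far end `pK`, partner's other port `sJ`, dominating forest class `N` with ports `{pK, v}`
  set sideP : Fin Mc → Fin (Mf + Mc) → Prop := fun K J => P J = P (Fin.natAdd Mf K) ∨ P' J = P (Fin.natAdd Mf K) with hsideP
  set qf : Fin Mc → Fin (Mf + Mc) → Fin n := fun K J => if sideP K J then P (Fin.natAdd Mf K) else P' (Fin.natAdd Mf K) with hqf
  set pKf : Fin Mc → Fin (Mf + Mc) → Fin n := fun K J => if sideP K J then P' (Fin.natAdd Mf K) else P (Fin.natAdd Mf K) with hpKf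
  set sJf : Fin Mc → Fin (Mf + Mc) → Fin n := fun K J => if P J = qf K J then P' J else P J with hsJf
  have hexA : ∀ K : Fin Mc, ∃ I : Fin Mf, (P (Fin.castAdd Mc I) = P (Fin.natAdd Mf K) ∨ P' (Fin.castAdd Mc I) = P (Fin.natAdd Mf K)) ∧
      (P (Fin.castAdd Mc I) ∉ ({P (Fin.natAdd Mf K), P' (Fin.natAdd Mf K)} : Finset (Fin n)) ∨
        P' (Fin.castAdd Mc I) ∉ ({P (Fin.natAdd Mf K), P' (Fin.natAdd Mf K)} : Finset (Fin n))) ∧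
      uu (Fin.castAdd Mc I) ≤ uu (Fin.natAdd Mf K) := fun K => hdomF K _ (Or.inl rfl)
  have hexB : ∀ K : Fin Mc, ∃ I : Fin Mf, (P (Fin.castAdd Mc I) = P' (Fin.natAdd Mf K) ∨ P' (Fin.castAdd Mc I) = P' (Fin.natAdd Mf K)) ∧
      (P (Fin.castAdd Mc I) ∉ ({P (Fin.natAdd Mf K), P' (Fin.natAdd Mf K)} : Finset (Fin n)) ∨
        P' (Fin.castAdd Mc I) ∉ ({P (Fin.natAdd Mf K), P' (Fin.natAdd Mf K)} : Finset (Fin n))) ∧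
      uu (Fin.castAdd Mc I) ≤ uu (Fin.natAdd Mf K) := fun K => hdomF K _ (Or.inr rfl)
  set Nf : Fin Mc → Fin (Mf + Mc) → Fin (Mf + Mc) := fun K J =>
    if sideP K J then Fin.castAdd Mc (Classical.choose (hexB K)) else Fin.castAdd Mc (Classical.choose (hexA K)) with hNf
  set vf : Fin Mc → Fin (Mf + Mc) → Fin n := fun K J => if P (Nf K J) = pKf K J then P' (Nf K J) else P (Nf K J) with hvf
  -- the facts about a pair `J ∈ AdjSet K`
  have hqK : ∀ K J, (P (Fin.natAdd Mf K) = qf K J ∧ P' (Fin.natAdd Mf K) = pKf K J) ∨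
      (P (Fin.natAdd Mf K) = pKf K J ∧ P' (Fin.natAdd Mf K) = qf K J) := by
    intro K J; by_cases h : sideP K J
    · left; constructor <;> simp only [hqf, hpKf, if_pos h]
    · right; constructor <;> simp only [hqf, hpKf, if_neg h]
  have hqneK : ∀ K J, qf K J ≠ pKf K J := fun K J h => (hqK K J).elim
    (fun h12 => hPP' _ (h12.1.trans (h.trans h12.2.symm))) fun h12 => hPP' _ (h12.1.trans (h12.2.trans h).symm)
  have hqJ : ∀ K, ∀ J ∈ AdjSet K, (P J = qf K J ∧ P' J = sJf K J) ∨ (P J = sJf K J ∧ P' J = qf K J) := by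
    intro K J hJ
    have ht := (hAdj K J hJ).2
    have hq : P J = qf K J ∨ P' J = qf K J := by
      by_cases h : sideP K J
      · simp only [hqf, if_pos h]; exact h
      · simp only [hqf, if_neg h]
        simp only [hsideP, not_or] at h
        rcases ht with h1 | h1 | h1 | h1
        · exact absurd h1 h.1
        · exact Or.inl h1
        · exact absurd h1 h.2
        · exact Or.inr h1
    by_cases h1 : P J = qf K J
    · left; refine ⟨h1, ?_⟩; simp only [hsJf, if_pos h1]
    · right; refine ⟨?_, hq.resolve_left h1⟩; simp only [hsJf, if_neg h1]
  have hqneJ : ∀ K, ∀ J ∈ AdjSet K, qf K J ≠ sJf K J := fun K J hJ h => (hqJ K J hJ).elim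
    (fun h12 => hPP' J (h12.1.trans (h.trans h12.2.symm))) fun h12 => hPP' J (h12.2.trans (h.trans h12.1.symm)).symm
  have hsJneK : ∀ K, ∀ J ∈ AdjSet K, sJf K J ≠ pKf K J := by
    intro K J hJ h
    have hne := (hAdj K J hJ).1
    apply hnopar (Fin.natAdd Mf K) J hne.symm
    -- ports of `J` are `{qf, sJf} = {qf, pKf}` = ports of `κ`
    rcases hqJ K J hJ with ⟨h1, h2⟩ | ⟨h1, h2⟩ <;> rcases hqK K J with ⟨h3, h4⟩ | ⟨h3, h4⟩
    · exact ⟨Or.inl (h1.trans h3.symm), Or.inr (h2.trans (h.trans h4.symm))⟩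
    · exact ⟨Or.inr (h1.trans h4.symm), Or.inl (h2.trans (h.trans h3.symm))⟩
    · exact ⟨Or.inr (h1.trans (h.trans h4.symm)), Or.inl (h2.trans h3.symm)⟩
    · exact ⟨Or.inl (h1.trans (h.trans h3.symm)), Or.inr (h2.trans h4.symm)⟩
  have hN : ∀ K J, (P (Nf K J) = pKf K J ∨ P' (Nf K J) = pKf K J) ∧
      (P (Nf K J) ∉ ({P (Fin.natAdd Mf K), P' (Fin.natAdd Mf K)} : Finset (Fin n)) ∨
        P' (Nf K J) ∉ ({P (Fin.natAdd Mf K), P' (Fin.natAdd Mf K)} : Finset (Fin n))) ∧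
      uu (Nf K J) ≤ uu (Fin.natAdd Mf K) ∧ (∃ I : Fin Mf, Nf K J = Fin.castAdd Mc I) := by
    intro K J
    by_cases h : sideP K J
    · have hs := Classical.choose_spec (hexB K)
      simp only [hNf, hpKf, if_pos h]
      exact ⟨hs.1, hs.2.1, hs.2.2, ⟨_, rfl⟩⟩
    · have hs := Classical.choose_spec (hexA K)
      simp only [hNf, hpKf, if_neg h]
      exact ⟨hs.1, hs.2.1, hs.2.2, ⟨_, rfl⟩⟩
  have hNv : ∀ K J, (P (Nf K J) = pKf K J ∧ P' (Nf K J) = vf K J) ∨ (P (Nf K J) = vf K J ∧ P' (Nf K J) = pKf K J) := by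
    intro K J
    by_cases h1 : P (Nf K J) = pKf K J
    · left; refine ⟨h1, ?_⟩; simp only [hvf, if_pos h1]
    · right; refine ⟨?_, (hN K J).1.resolve_left h1⟩; simp only [hvf, if_neg h1]
  have hKnev : ∀ K J, pKf K J ≠ vf K J := fun K J h => (hNv K J).elim
    (fun h12 => hPP' _ (h12.1.trans (h.trans h12.2.symm))) fun h12 => hPP' _ (h12.2.trans (h.trans h12.1.symm)).symm
  have hvoff : ∀ K J, vf K J ≠ P (Fin.natAdd Mf K) ∧ vf K J ≠ P' (Fin.natAdd Mf K) := by
    intro K J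
    have hoff := (hN K J).2.1
    have hKin : pKf K J = P (Fin.natAdd Mf K) ∨ pKf K J = P' (Fin.natAdd Mf K) := by
      rcases hqK K J with ⟨_, h2⟩ | ⟨h1, _⟩
      · exact Or.inr h2.symm
      · exact Or.inl h1.symm
    rcases hNv K J with ⟨h1, h2⟩ | ⟨h1, h2⟩
    · -- P N = pK ∈ κ, so P' N = v is the port off κ
      rcases hoff with ho | ho
      · exact absurd (by rw [h1]; simp only [mem_insert, mem_singleton]; exact hKin) ho
      · rw [h2] at ho; simp only [mem_insert, mem_singleton, not_or] at ho; exact ho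
    · rcases hoff with ho | ho
      · rw [h1] at ho; simp only [mem_insert, mem_singleton, not_or] at ho; exact ho
      · exact absurd (by rw [h2]; simp only [mem_insert, mem_singleton]; exact hKin) ho
  have hqnev : ∀ K J, qf K J ≠ vf K J := by
    intro K J h
    rcases hqK K J with ⟨h1, _⟩ | ⟨_, h2⟩
    · exact (hvoff K J).1 (h.symm.trans h1.symm)
    · exact (hvoff K J).2 (h.symm.trans h2.symm)
  have hNne : ∀ K J, Nf K J ≠ Fin.natAdd Mf K := by
    intro K J h
    obtain ⟨I, hI⟩ := (hN K J).2.2.2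
    have : ((Fin.castAdd Mc I : Fin (Mf + Mc)) : ℕ) = ((Fin.natAdd Mf K : Fin (Mf + Mc)) : ℕ) := by rw [← hI, h]
    simp at this; omega
  have hJneN : ∀ K, ∀ J ∈ AdjSet K, J ≠ Nf K J := by
    intro K J hJ h
    -- `J = N` would have ports `{qf, sJf} = {pKf, vf}`, forcing `qf = pKf` or `qf = vf`
    have hPJ : P J = P (Nf K J) := congrArg P h
    have hP'J : P' J = P' (Nf K J) := congrArg P' h
    rcases hqJ K J hJ with ⟨h1, h2⟩ | ⟨h1, h2⟩ <;> rcases hNv K J with ⟨h3, h4⟩ | ⟨h3, h4⟩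
    · exact hqneK K J (h1.symm.trans (hPJ.trans h3))
    · exact hqnev K J (h1.symm.trans (hPJ.trans h3))
    · exact hqnev K J (h2.symm.trans (hP'J.trans h4))
    · exact hqneK K J (h2.symm.trans (hP'J.trans h4))
  have hports : ∀ (x : Fin m) (κ : Fin (Mf + Mc)) (d d' : Fin n), cls x = κ →
      ((P κ = d ∧ P' κ = d') ∨ (P κ = d' ∧ P' κ = d)) → ((p x = d ∧ p' x = d') ∨ (p x = d' ∧ p' x = d)) := by
    intro x κ d d' hx h; rw [hP x, hP' x, hx]; exact h
  have hdirfact : ∀ (x : Fin m) (d : Fin n), (p x = d ∨ p' x = d) →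
      (((if d = p x then (1 : Fin 3) else 2) = 1 ∧ d = p x) ∨ ((if d = p x then (1 : Fin 3) else 2) = 2 ∧ d = p' x)) := by
    intro x d h
    by_cases hd : d = p x
    · left; rw [if_pos hd]; exact ⟨rfl, hd⟩
    · right; rw [if_neg hd]; exact ⟨rfl, (h.resolve_left (fun h' => hd h'.symm)).symm⟩
  set W₁ : Fin Mc → Fin (Mf + Mc) → Fin m → Fin m → Fin m → (Fin m → Fin 3) := fun K J i j nn x =>
    if x = i then (if qf K J = p x then (1 : Fin 3) else 2) else if x = j then (if sJf K J = p x then (1 : Fin 3) else 2)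
      else if x = nn then (if pKf K J = p x then (1 : Fin 3) else 2) else 0 with hW₁
  set W₂ : Fin Mc → Fin (Mf + Mc) → Fin m → Fin m → Fin m → (Fin m → Fin 3) := fun K J i j nn x =>
    if x = i then (if pKf K J = p x then (1 : Fin 3) else 2) else if x = j then (if qf K J = p x then (1 : Fin 3) else 2)
      else if x = nn then (if vf K J = p x then (1 : Fin 3) else 2) else 0 with hW₂
  have hstars : ∀ K, ∀ J ∈ AdjSet K, ∀ i ∈ St (Fin.natAdd Mf K), ∀ j ∈ St J,
      i ≠ j ∧ i ∉ St (Nf K J) ∧ j ∉ St (Nf K J) := by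
    intro K J hJ i hi j hj
    simp only [hSt, mem_filter, mem_univ, true_and] at hi hj ⊢
    exact ⟨fun h => (hAdj K J hJ).1 (hj.symm.trans (h ▸ hi)), fun h => hNne K J (h.symm.trans hi), fun h => hJneN K J hJ (hj.symm.trans h)⟩
  have h5 : ∀ K, ∀ J ∈ AdjSet K, ∀ i ∈ St (Fin.natAdd Mf K), ∀ j ∈ St J,
      8 * C0 * (θ i * θ j) ≤ ∑ nn ∈ St (Nf K J), (coef (W₁ K J i j nn) + coef (W₂ K J i j nn)) := by
    intro K J hJ i hi j hj
    obtain ⟨hij, hiN, hjN⟩ := hstars K J hJ i hi j hj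
    have hi' : cls i = Fin.natAdd Mf K := by simpa [hSt] using hi
    have hj' : cls j = J := by simpa [hSt] using hj
    have hS : Real.sqrt (θ i) ≤ ∑ x ∈ St (Nf K J), Real.sqrt (θ x) :=
      sqrt_le_sum_sqrt_of_dominated (St (Fin.natAdd Mf K)) (St (Nf K J)) θ hθ0 hθ1 hi (hN K J).2.2.1
    have h := pair_words_supply w s p p' hij (St (Nf K J)) hiN hjN (qf K J) (pKf K J) (sJf K J) (vf K J)
      (hports i _ _ _ hi' (hqK K J)) (hports j _ _ _ hj' (hqJ K J hJ))
      (fun x hx => hports x _ _ _ (by simpa [hSt] using hx) (hNv K J)) (hqneK K J) (hqneJ K J hJ) (hKnev K J) hS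
    have hθi : θ i = (w s(s i, p i) : ℝ) * w s(s i, p' i) := rfl
    calc 8 * C0 * (θ i * θ j) = 8 * θ i * θ j * C0 := by ring
      _ ≤ _ := h
  have h6 : ∑ K, ∑ J ∈ AdjSet K, ∑ i ∈ St (Fin.natAdd Mf K), ∑ j ∈ St J, C0 * (θ i * θ j) ≤
      (1 / 8) * ∑ K, ∑ J ∈ AdjSet K, ∑ i ∈ St (Fin.natAdd Mf K), ∑ j ∈ St J,
        ∑ nn ∈ St (Nf K J), (coef (W₁ K J i j nn) + coef (W₂ K J i j nn)) := by
    rw [mul_sum]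
    refine sum_le_sum fun K _ => ?_
    rw [mul_sum]
    refine sum_le_sum fun J hJ => ?_
    rw [mul_sum]
    refine sum_le_sum fun i hi => ?_
    rw [mul_sum]
    refine sum_le_sum fun j hj => ?_
    have := h5 K J hJ i hi j hj
    linarith
  refine le_trans h6 ?_
  -- the charge set as an iterated sigma type
  set X := ((((univ : Finset (Fin Mc)).sigma fun K => AdjSet K).sigma fun KJ => St (Fin.natAdd Mf KJ.1)).sigma
    fun KJi => St KJi.1.2).sigma fun KJij => St (Nf KJij.1.1.1 KJij.1.1.2) with hX
  set φ : ((_ : (_ : (_ : (_ : Fin Mc) × Fin (Mf + Mc)) × Fin m) × Fin m) × Fin m) × Bool → (Fin m → Fin 3) :=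
    fun xb => if xb.2 then W₁ xb.1.1.1.1.1 xb.1.1.1.1.2 xb.1.1.1.2 xb.1.1.2 xb.1.2
      else W₂ xb.1.1.1.1.1 xb.1.1.1.1.2 xb.1.1.1.2 xb.1.1.2 xb.1.2 with hφ
  set π : ((_ : (_ : (_ : (_ : Fin Mc) × Fin (Mf + Mc)) × Fin m) × Fin m) × Fin m) × Bool → Fin m × Fin m :=
    fun xb => (xb.1.1.1.2, xb.1.1.2) with hπ
  have hsumX : ∑ K, ∑ J ∈ AdjSet K, ∑ i ∈ St (Fin.natAdd Mf K), ∑ j ∈ St J,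
      ∑ nn ∈ St (Nf K J), (coef (W₁ K J i j nn) + coef (W₂ K J i j nn)) = ∑ xb ∈ X ×ˢ (univ : Finset Bool), coef (φ xb) := by
    rw [sum_product]
    simp only [hX, sum_sigma]
    refine sum_congr rfl fun K _ => sum_congr rfl fun J _ => sum_congr rfl fun i _ => sum_congr rfl fun j _ =>
      sum_congr rfl fun nn _ => ?_
    rw [Fintype.sum_bool]
    simp only [hφ]
    simp
  rw [hsumX]
  set E3 : Finset (Fin m → Fin 3) := univ.filter (fun e => 3 ≤ (Rw e).card) with hE3
  have hbudget : ∑ e, (if 3 ≤ (Rw e).card then coef e else 0) = ∑ e ∈ E3, coef e := by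
    rw [hE3, sum_filter]
  rw [hbudget]
  -- membership facts for elements of `X`
  have hmemX : ∀ xb ∈ X ×ˢ (univ : Finset Bool), xb.1.1.1.1.2 ∈ AdjSet xb.1.1.1.1.1 ∧
      xb.1.1.1.2 ∈ St (Fin.natAdd Mf xb.1.1.1.1.1) ∧ xb.1.1.2 ∈ St xb.1.1.1.1.2 ∧ xb.1.2 ∈ St (Nf xb.1.1.1.1.1 xb.1.1.1.1.2) := by
    intro xb hxb
    have hx := (mem_product.1 hxb).1
    simp only [hX, mem_sigma, mem_univ, true_and] at hx
    exact ⟨hx.1.1.1, hx.1.1.2, hx.1.2, hx.2⟩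
  -- values of the words at the designated stars and elsewhere
  have hWval : ∀ K J i j nn, i ≠ j → nn ≠ i → nn ≠ j →
      (W₁ K J i j nn i = (if qf K J = p i then (1 : Fin 3) else 2) ∧ W₁ K J i j nn j = (if sJf K J = p j then (1 : Fin 3) else 2) ∧
        W₁ K J i j nn nn = (if pKf K J = p nn then (1 : Fin 3) else 2) ∧ (∀ x, x ≠ i → x ≠ j → x ≠ nn → W₁ K J i j nn x = 0)) ∧
      (W₂ K J i j nn i = (if pKf K J = p i then (1 : Fin 3) else 2) ∧ W₂ K J i j nn j = (if qf K J = p j then (1 : Fin 3) else 2) ∧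
        W₂ K J i j nn nn = (if vf K J = p nn then (1 : Fin 3) else 2) ∧ (∀ x, x ≠ i → x ≠ j → x ≠ nn → W₂ K J i j nn x = 0)) := by
    intro K J i j nn hij hni hnj
    refine ⟨⟨?_, ?_, ?_, fun x h1 h2 h3 => ?_⟩, ⟨?_, ?_, ?_, fun x h1 h2 h3 => ?_⟩⟩
    · simp only [hW₁, if_true]
    · simp only [hW₁, if_neg hij.symm, if_true]
    · simp only [hW₁, if_neg hni, if_neg hnj, if_true]
    · simp only [hW₁, if_neg h1, if_neg h2, if_neg h3]
    · simp only [hW₂, if_true]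
    · simp only [hW₂, if_neg hij.symm, if_true]
    · simp only [hW₂, if_neg hni, if_neg hnj, if_true]
    · simp only [hW₂, if_neg h1, if_neg h2, if_neg h3]
  have h12 : ∀ (d : Fin n) (x : Fin m), (if d = p x then (1 : Fin 3) else 2) ≠ 0 := by
    intro d x; split_ifs <;> decide
  have hfib := sum_le_six_mul_of_fibres (X ×ˢ (univ : Finset Bool)) φ π coef hcoefnn E3 ?_ ?_ ?_ ?_
  · linarith [hfib, sum_nonneg fun e (_ : e ∈ E3) => hcoefnn e]
  · -- every word is a budget word
    intro xb hxb
    obtain ⟨hJ, hi, hj, hnn⟩ := hmemX xb hxb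
    obtain ⟨hij, hiN, hjN⟩ := hstars _ _ hJ _ hi _ hj
    have hni : xb.1.2 ≠ xb.1.1.1.2 := fun h => hiN (h ▸ hnn)
    have hnj : xb.1.2 ≠ xb.1.1.2 := fun h => hjN (h ▸ hnn)
    have hi' : cls xb.1.1.1.2 = Fin.natAdd Mf xb.1.1.1.1.1 := by simpa [hSt] using hi
    have hj' : cls xb.1.1.2 = xb.1.1.1.1.2 := by simpa [hSt] using hj
    have hnn' : cls xb.1.2 = Nf xb.1.1.1.1.1 xb.1.1.1.1.2 := by simpa [hSt] using hnn
    obtain ⟨hv1, hv2⟩ := hWval xb.1.1.1.1.1 xb.1.1.1.1.2 xb.1.1.1.2 xb.1.1.2 xb.1.2 hij hni hnj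
    rw [hE3, mem_filter]; refine ⟨mem_univ _, ?_⟩
    have hpi := hports _ _ _ _ hi' (hqK xb.1.1.1.1.1 xb.1.1.1.1.2)
    have hpj := hports _ _ _ _ hj' (hqJ _ _ hJ)
    have hpn := hports _ _ _ _ hnn' (hNv xb.1.1.1.1.1 xb.1.1.1.1.2)
    rcases Bool.eq_false_or_eq_true xb.2 with hb | hb
    · simp only [hφ, hb, if_true, hRw]
      refine three_le_card_ports p p' _ xb.1.1.1.2 xb.1.1.2 xb.1.2 (qf xb.1.1.1.1.1 xb.1.1.1.1.2) (sJf xb.1.1.1.1.1 xb.1.1.1.1.2)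
        (pKf xb.1.1.1.1.1 xb.1.1.1.1.2) ?_ ?_ ?_ (hqneJ _ _ hJ) (hqneK xb.1.1.1.1.1 xb.1.1.1.1.2) (hsJneK _ _ hJ)
      · rw [hv1.1]; exact hdirfact _ _ (hpi.elim (fun h => Or.inl h.1) fun h => Or.inr h.2)
      · rw [hv1.2.1]; exact hdirfact _ _ (hpj.elim (fun h => Or.inr h.2) fun h => Or.inl h.1)
      · rw [hv1.2.2.1]; exact hdirfact _ _ (hpn.elim (fun h => Or.inl h.1) fun h => Or.inr h.2)
    · simp only [hφ, hb, Bool.false_eq_true, if_false, hRw]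
      refine three_le_card_ports p p' _ xb.1.1.1.2 xb.1.1.2 xb.1.2 (pKf xb.1.1.1.1.1 xb.1.1.1.1.2) (qf xb.1.1.1.1.1 xb.1.1.1.1.2)
        (vf xb.1.1.1.1.1 xb.1.1.1.1.2) ?_ ?_ ?_
        (hqneK xb.1.1.1.1.1 xb.1.1.1.1.2).symm (hKnev xb.1.1.1.1.1 xb.1.1.1.1.2) (hqnev xb.1.1.1.1.1 xb.1.1.1.1.2)
      · rw [hv2.1]; exact hdirfact _ _ (hpi.elim (fun h => Or.inr h.2) fun h => Or.inl h.1)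
      · rw [hv2.2.1]; exact hdirfact _ _ (hpj.elim (fun h => Or.inl h.1) fun h => Or.inr h.2)
      · rw [hv2.2.2.1]; exact hdirfact _ _ (hpn.elim (fun h => Or.inr h.2) fun h => Or.inl h.1)
  · -- injectivity given the word and `(i, j)`
    intro xb hxb yb hyb hφe hπe
    obtain ⟨hJ, hi, hj, hnn⟩ := hmemX xb hxb
    obtain ⟨hJ', hi2, hj2, hnn2⟩ := hmemX yb hyb
    obtain ⟨⟨⟨⟨⟨K, J⟩, i⟩, j⟩, nn⟩, b⟩ := xb
    obtain ⟨⟨⟨⟨⟨K', J'⟩, i'⟩, j'⟩, nn'⟩, b'⟩ := yb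
    simp only [hπ, Prod.mk.injEq] at hπe
    obtain ⟨rfl, rfl⟩ := hπe
    simp only at hJ hi hj hnn hJ' hi2 hj2 hnn2 hφe ⊢
    have hi' : cls i = Fin.natAdd Mf K := by simpa [hSt] using hi
    have hi2' : cls i = Fin.natAdd Mf K' := by simpa [hSt] using hi2
    have hKK : K = K' := by
      have h := hi'.symm.trans hi2'
      have hv : ((Fin.natAdd Mf K : Fin (Mf + Mc)) : ℕ) = ((Fin.natAdd Mf K' : Fin (Mf + Mc)) : ℕ) := by rw [h]
      simp at hv; exact Fin.ext hv
    subst hKK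
    have hJJ : J = J' := (by simpa [hSt] using hj : cls j = J).symm.trans (by simpa [hSt] using hj2)
    subst hJJ
    obtain ⟨hij, hiN, hjN⟩ := hstars _ _ hJ _ hi _ hj
    have hni : nn ≠ i := fun h => hiN (h ▸ hnn)
    have hnj : nn ≠ j := fun h => hjN (h ▸ hnn)
    have hni2 : nn' ≠ i := fun h => hiN (h ▸ hnn2)
    have hnj2 : nn' ≠ j := fun h => hjN (h ▸ hnn2)
    obtain ⟨hv1, hv2⟩ := hWval K J i j nn hij hni hnj
    obtain ⟨hv1', hv2'⟩ := hWval K J i j nn' hij hni2 hnj2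
    have hpi := hports _ _ _ _ (by simpa [hSt] using hi : cls i = Fin.natAdd Mf K) (hqK K J)
    -- the word index `b` is read off at star `i`
    have hbb : b = b' := by
      by_contra hne
      have hval : φ ⟨⟨⟨⟨⟨K, J⟩, i⟩, j⟩, nn⟩, b⟩ i = φ ⟨⟨⟨⟨⟨K, J⟩, i⟩, j⟩, nn'⟩, b'⟩ i := by rw [hφe]
      have key : (if qf K J = p i then (1 : Fin 3) else 2) = (if pKf K J = p i then (1 : Fin 3) else 2) := by
        rcases Bool.eq_false_or_eq_true b with hb | hb <;> rcases Bool.eq_false_or_eq_true b' with hb' | hb'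
        · exact absurd (hb.trans hb'.symm) hne
        · simp only [hφ, hb, hb', Bool.false_eq_true, if_true, if_false] at hval; rw [hv1.1, hv2'.1] at hval; exact hval
        · simp only [hφ, hb, hb', Bool.false_eq_true, if_true, if_false] at hval; rw [hv2.1, hv1'.1] at hval; exact hval.symm
        · exact absurd (hb.trans hb'.symm) hne
      rcases hpi with ⟨h1, h2⟩ | ⟨h1, h2⟩
      · rw [if_pos h1.symm, if_neg (fun h => hqneK K J (h1.symm.trans h.symm))] at key; exact absurd key (by decide)
      · rw [if_neg (fun h => hqneK K J (h.trans h1)), if_pos h1.symm] at key; exact absurd key (by decide)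
    subst hbb
    -- the third star is the remaining designated star
    have hnn_eq : nn' = nn := by
      have hval : φ ⟨⟨⟨⟨⟨K, J⟩, i⟩, j⟩, nn⟩, b⟩ nn' ≠ 0 := by
        rw [hφe]
        rcases Bool.eq_false_or_eq_true b with hb | hb
        · simp only [hφ, hb, if_true]; rw [hv1'.2.2.1]; exact h12 _ _
        · simp only [hφ, hb, Bool.false_eq_true, if_false]; rw [hv2'.2.2.1]; exact h12 _ _
      rcases Bool.eq_false_or_eq_true b with hb | hb
      · simp only [hφ, hb, if_true] at hval
        exact eq_third_of_designated _ i j nn hv1.2.2.2 nn' hval hni2 hnj2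
      · simp only [hφ, hb, Bool.false_eq_true, if_false] at hval
        exact eq_third_of_designated _ i j nn hv2.2.2.2 nn' hval hni2 hnj2
    subst hnn_eq
    rfl
  · -- labels are distinct designated stars
    intro xb hxb
    obtain ⟨hJ, hi, hj, hnn⟩ := hmemX xb hxb
    obtain ⟨hij, hiN, hjN⟩ := hstars _ _ hJ _ hi _ hj
    have hni : xb.1.2 ≠ xb.1.1.1.2 := fun h => hiN (h ▸ hnn)
    have hnj : xb.1.2 ≠ xb.1.1.2 := fun h => hjN (h ▸ hnn)
    obtain ⟨hv1, hv2⟩ := hWval xb.1.1.1.1.1 xb.1.1.1.1.2 xb.1.1.1.2 xb.1.1.2 xb.1.2 hij hni hnj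
    refine ⟨hij, ?_, ?_⟩
    · rcases Bool.eq_false_or_eq_true xb.2 with hb | hb
      · simp only [hφ, hπ, hb, if_true]; rw [hv1.1]; exact h12 _ _
      · simp only [hφ, hπ, hb, Bool.false_eq_true, if_false]; rw [hv2.1]; exact h12 _ _
    · rcases Bool.eq_false_or_eq_true xb.2 with hb | hb
      · simp only [hφ, hπ, hb, if_true]; rw [hv1.2.1]; exact h12 _ _
      · simp only [hφ, hπ, hb, Bool.false_eq_true, if_false]; rw [hv2.2.1]; exact h12 _ _
  · -- at most three designated stars
    intro xb hxb
    obtain ⟨hJ, hi, hj, hnn⟩ := hmemX xb hxb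
    obtain ⟨hij, hiN, hjN⟩ := hstars _ _ hJ _ hi _ hj
    have hni : xb.1.2 ≠ xb.1.1.1.2 := fun h => hiN (h ▸ hnn)
    have hnj : xb.1.2 ≠ xb.1.1.2 := fun h => hjN (h ▸ hnn)
    obtain ⟨hv1, hv2⟩ := hWval xb.1.1.1.1.1 xb.1.1.1.1.2 xb.1.1.1.2 xb.1.1.2 xb.1.2 hij hni hnj
    rcases Bool.eq_false_or_eq_true xb.2 with hb | hb
    · simp only [hφ, hb, if_true]
      refine card_designated_le_three _ xb.1.1.1.2 xb.1.1.2 xb.1.2 ?_ ?_ ?_ hv1.2.2.2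
      · rw [hv1.1]; exact h12 _ _
      · rw [hv1.2.1]; exact h12 _ _
      · rw [hv1.2.2.1]; exact h12 _ _
    · simp only [hφ, hb, Bool.false_eq_true, if_false]
      refine card_designated_le_three _ xb.1.1.1.2 xb.1.1.2 xb.1.2 ?_ ?_ ?_ hv2.2.2.2
      · rw [hv2.1]; exact h12 _ _
      · rw [hv2.2.1]; exact h12 _ _
      · rw [hv2.2.2.1]; exact h12 _ _

end StarSet

end Summit.CriticalPhenomena.PercolationContinuityZ3.Theorems

end
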